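import Summits.AtomisticToContinuum.FouriersLaw.Theorems.BoundaryEscapeDeficitHalfChainLocalityLipschitz
import Summits.AtomisticToContinuum.FouriersLaw.Theorems.BoundaryEscapeDeficitHalfChainLocalityIteration

/-!
# Common-noise locality of the pinned-chain flow at the left boundary across chain lengths

Helper file (`--supports stmt-AtomisticToContinuum-12240`, item `HalfChainLocality` of route
`BoundaryEscapeDeficit`, sub-problem `FouriersLaw`). The DETERMINISTIC core of the existence of the
half-line boundary curve: compare the `N`-chain flow `z = chainFlow N x η_N` with the flow
`z' = chainFlow (ℓ+1) (take x) η'` of the SHORTER `(ℓ+1)`-chain (`1 ≤ ℓ`, `ℓ+1 ≤ N`) started from the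
restriction of `x` to the first `ℓ+1` sites and driven by a noise path with the SAME components on the
sites `k < ℓ` (in the application: the same left Brownian motion at site `0`, no noise in between). On
the sites `k < ℓ` the two integral equations are literally the same (`…HalfChainLocalityLipschitz`), so
the deviations `w_k = |δq_k| + |δp_k|`, which vanish at time `0`, are driven only through the position
of the last window site `ℓ`; if all window positions of both flows stay in `[-R, R]` (`R ≥ 1`) on
`[0, t]`, they obey `w_k(τ) ≤ A ∫₀^τ (w_{k-1} + w_k + w_{k+1})` (`w_{-1} = 0`, `w_ℓ := 2R`) with the
box Lipschitz constant `A = 1 + γ + ω₂ + 3 lam R² + 2(1 + 12βR²)`, and the abstract boundary-source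
iteration (`boundary_lattice_iteration`) gives

  `|p_0(τ) - p'_0(τ)| ≤ 2R · (3Aτ)^ℓ/ℓ! · e^{3Aτ}`        (`τ ∈ [0, t]`)

— super-exponentially small in the window size `ℓ` as long as `R² = o(ℓ)`.

* `pinnedChain_chainFlow_window_propagation` (**main**).

Folklore (finite-time locality of lattice dynamics with superlinear forces à la
Lanford–Lebowitz–Lieb 1977 / Dobrushin–Fritz 1977 / Buttà–Marchioro 2016, here with a common additive
boundary noise); no probability and no definitions in this file.
-/

noncomputable section

open MeasureTheory Set Filter Topology

namespace Summit.AtomisticToContinuum.FouriersLaw.Theorems.HalfChainLocality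

open Literature.MathematicalPhysics.KineticTheory.HeatConduction
open Summit.AtomisticToContinuum.FouriersLaw.Theorems.NonBallistic
open Summit.AtomisticToContinuum.FouriersLaw.Theorems.NonBallistic.LightConePropagation

variable {ω₂ lam β γ : ℝ}

/-- A continuous real function on `[0, t]` indexed by `k < ℓ` admits a common upper bound there.
[folklore] -/
theorem exists_common_bound_of_continuousOn {ℓ : ℕ} {t : ℝ} {w : ℕ → ℝ → ℝ}
    (hw : ∀ k, k < ℓ → ContinuousOn (w k) (Icc 0 t)) :
    ∃ B : ℝ, ∀ k, k < ℓ → ∀ s ∈ Icc 0 t, w k s ≤ B := by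
  induction ℓ with
  | zero => exact ⟨0, fun k hk => absurd hk (Nat.not_lt_zero k)⟩
  | succ ℓ ih =>
    obtain ⟨B, hB⟩ := ih fun k hk => hw k (Nat.lt_succ_of_lt hk)
    obtain ⟨B', hB'⟩ := isCompact_Icc.exists_bound_of_continuousOn (hw ℓ (Nat.lt_succ_self ℓ))
    refine ⟨max B B', fun k hk s hs => ?_⟩
    rcases Nat.lt_succ_iff_lt_or_eq.1 hk with h | rfl
    · exact (hB k h s hs).trans (le_max_left _ _)
    · exact ((le_abs_self _).trans ((Real.norm_eq_abs _).symm.le.trans (hB' s hs))).trans (le_max_right _ _)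

/-- `|∫₀^τ f| ≤ ∫₀^τ g` when `|f| ≤ g` on `[0, τ]`, for continuous-on-`[0,τ]` integrands. [folklore] -/
theorem abs_intervalIntegral_le_of_abs_le {f g : ℝ → ℝ} {τ : ℝ} (hτ : 0 ≤ τ)
    (hf : ContinuousOn f (Icc 0 τ)) (hg : ContinuousOn g (Icc 0 τ)) (h : ∀ s ∈ Icc 0 τ, |f s| ≤ g s) :
    |∫ s in (0:ℝ)..τ, f s| ≤ ∫ s in (0:ℝ)..τ, g s := by
  have hfi : IntervalIntegrable f volume 0 τ := hf.intervalIntegrable_of_Icc hτ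
  have hgi : IntervalIntegrable g volume 0 τ := hg.intervalIntegrable_of_Icc hτ
  calc |∫ s in (0:ℝ)..τ, f s| ≤ ∫ s in (0:ℝ)..τ, |f s| :=
        intervalIntegral.abs_integral_le_integral_abs hτ
    _ ≤ ∫ s in (0:ℝ)..τ, g s :=
        intervalIntegral.integral_mono_on hτ hfi.abs hgi h

/-- **Common-noise locality at the left boundary across chain lengths.** Let `1 ≤ ℓ`, `ℓ + 1 ≤ N`,
`x ∈ PhaseSpace N`, and let `η_N`, `η'` be continuous momentum-noise paths of the `N`- and the
`(ℓ+1)`-chain with equal components on the sites `k < ℓ`. Let `z = chainFlow N x η_N` and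
`z' = chainFlow (ℓ+1) (take_{ℓ+1} x) η'`. If all positions of both flows on the window `k ≤ ℓ` stay
in `[-R, R]` (`R ≥ 1`) for times in `[0, t]`, then for `τ ∈ [0, t]`
`|p_0(τ) - p'_0(τ)| ≤ 2R · (3Aτ)^ℓ/ℓ! · e^{3Aτ}`, `A = 1 + γ + ω₂ + 3 lam R² + 2(1 + 12βR²)`.
[folklore] -/
theorem pinnedChain_chainFlow_window_propagation (hω : 0 < ω₂) (hl : 0 ≤ lam) (hβ : 0 ≤ β) (hγ : 0 ≤ γ)
    {ℓ N : ℕ} (hℓ : 1 ≤ ℓ) (hℓN : ℓ + 1 ≤ N) (x : PhaseSpace N)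
    {ηN : ℝ → Fin N → ℝ} (hηN : Continuous ηN) {ηn : ℝ → Fin (ℓ + 1) → ℝ} (hηn : Continuous ηn)
    (hη : ∀ (s : ℝ) (k : ℕ) (hk : k < ℓ), ηN s ⟨k, by omega⟩ = ηn s ⟨k, by omega⟩)
    {R t : ℝ} (hR : 1 ≤ R)
    (hbox : ∀ s ∈ Icc 0 t, ∀ (k : ℕ) (hk : k ≤ ℓ),
      |((pinnedChain ω₂ lam β γ).chainFlow N x ηN s).1 ⟨k, by omega⟩| ≤ R ∧
      |((pinnedChain ω₂ lam β γ).chainFlow (ℓ + 1)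
          ((Fin.take (ℓ + 1) hℓN x.1 : Fin (ℓ + 1) → ℝ), (Fin.take (ℓ + 1) hℓN x.2 : Fin (ℓ + 1) → ℝ)) ηn s).1
        ⟨k, by omega⟩| ≤ R)
    (τ : ℝ) (hτ : τ ∈ Icc 0 t) :
    |((pinnedChain ω₂ lam β γ).chainFlow N x ηN τ).2 ⟨0, by omega⟩ -
        ((pinnedChain ω₂ lam β γ).chainFlow (ℓ + 1)
          ((Fin.take (ℓ + 1) hℓN x.1 : Fin (ℓ + 1) → ℝ), (Fin.take (ℓ + 1) hℓN x.2 : Fin (ℓ + 1) → ℝ)) ηn τ).2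
        ⟨0, by omega⟩| ≤
      2 * R * ((3 * (1 + γ + ω₂ + 3 * lam * R ^ 2 + 2 * (1 + 12 * β * R ^ 2)) * τ) ^ ℓ / (ℓ.factorial : ℝ)) *
        Real.exp (3 * (1 + γ + ω₂ + 3 * lam * R ^ 2 + 2 * (1 + 12 * β * R ^ 2)) * τ) := by
  set P := pinnedChain ω₂ lam β γ with hP
  set x' : PhaseSpace (ℓ + 1) :=
    ((Fin.take (ℓ + 1) hℓN x.1 : Fin (ℓ + 1) → ℝ), (Fin.take (ℓ + 1) hℓN x.2 : Fin (ℓ + 1) → ℝ)) with hx'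
  set zN : ℝ → PhaseSpace N := fun s => P.chainFlow N x ηN s with hzN
  set zn : ℝ → PhaseSpace (ℓ + 1) := fun s => P.chainFlow (ℓ + 1) x' ηn s with hzn
  set cV : ℝ := 1 + 12 * β * R ^ 2 with hcV
  set cU : ℝ := ω₂ + 3 * lam * R ^ 2 + 2 * (1 + 12 * β * R ^ 2) with hcU
  set A : ℝ := 1 + γ + ω₂ + 3 * lam * R ^ 2 + 2 * (1 + 12 * β * R ^ 2) with hA
  have hR0 : 0 ≤ R := zero_le_one.trans hR
  have hcV0 : 0 ≤ cV := by positivity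
  have hcVA : cV ≤ A := by rw [hcV, hA]; nlinarith [sq_nonneg R, hω.le]
  have hA0 : 0 ≤ A := hcV0.trans hcVA
  have hAU : 1 + cU + γ = A := by rw [hcU, hA]; ring
  have ht : τ ≤ t := hτ.2
  -- the deviations on the window
  set w : ℕ → ℝ → ℝ := fun k s => if hk : k ≤ ℓ then
      |(zn s).1 ⟨k, by omega⟩ - (zN s).1 ⟨k, by omega⟩| + |(zn s).2 ⟨k, by omega⟩ - (zN s).2 ⟨k, by omega⟩|
    else 0 with hw
  have hw_eq : ∀ (k : ℕ) (hk : k ≤ ℓ) (s : ℝ), w k s =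
      |(zn s).1 ⟨k, by omega⟩ - (zN s).1 ⟨k, by omega⟩| + |(zn s).2 ⟨k, by omega⟩ - (zN s).2 ⟨k, by omega⟩| := by
    intro k hk s
    simp only [hw, dif_pos hk]
  have hw_nn : ∀ k s, 0 ≤ w k s := by
    intro k s
    simp only [hw]
    split_ifs
    · positivity
    · exact le_rfl
  -- continuity of the coordinates and of the deviations
  have hcN := fun (i : Fin N) => pinnedChain_continuous_chainFlow_apply hω hl hβ hγ N x hηN i
  have hcn := fun (i : Fin (ℓ + 1)) => pinnedChain_continuous_chainFlow_apply hω hl hβ hγ (ℓ + 1) x' hηn i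
  have hw_cont' : ∀ (k : ℕ) (hk : k ≤ ℓ), Continuous (w k) := by
    intro k hk
    have e : w k = fun s => |(zn s).1 ⟨k, by omega⟩ - (zN s).1 ⟨k, by omega⟩| +
        |(zn s).2 ⟨k, by omega⟩ - (zN s).2 ⟨k, by omega⟩| := funext fun s => hw_eq k hk s
    rw [e]
    obtain ⟨h1, h2, -⟩ := hcN ⟨k, by omega⟩
    obtain ⟨h1', h2', -⟩ := hcn ⟨k, by omega⟩
    exact ((h1'.sub h1).abs).add ((h2'.sub h2).abs)
  have hw_cont : ∀ k, k < ℓ → ContinuousOn (w k) (Icc 0 t) := fun k hk =>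
    (hw_cont' k hk.le).continuousOn
  -- a priori bound
  obtain ⟨B₀, hB₀⟩ := exists_common_bound_of_continuousOn hw_cont
  set B : ℝ := max B₀ (2 * R) with hB
  have hw_bd : ∀ k, k < ℓ → ∀ s ∈ Icc 0 t, w k s ≤ B := fun k hk s hs => (hB₀ k hk s hs).trans (le_max_left _ _)
  -- initial data agree on the window
  have hx1 : ∀ (k : ℕ) (hk : k ≤ ℓ), x'.1 ⟨k, by omega⟩ = x.1 ⟨k, by omega⟩ := by
    intro k hk; simp [hx', Fin.take_apply, Fin.castLE]
  have hx2 : ∀ (k : ℕ) (hk : k ≤ ℓ), x'.2 ⟨k, by omega⟩ = x.2 ⟨k, by omega⟩ := by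
    intro k hk; simp [hx', Fin.take_apply, Fin.castLE]
  -- the integral inequalities
  have hw_int : ∀ k, k < ℓ → ∀ τ' ∈ Icc 0 t, w k τ' ≤ A * ∫ s in (0:ℝ)..τ',
      ((if k = 0 then 0 else w (k - 1) s) + w k s + (if k + 1 < ℓ then w (k + 1) s else 2 * R)) := by
    intro k hk τ' hτ'
    obtain ⟨hτ'0, hτ't⟩ := hτ'
    obtain ⟨hq1, hp1, hY1⟩ := hcN ⟨k, by omega⟩
    obtain ⟨hq1', hp1', hY1'⟩ := hcn ⟨k, by omega⟩
    -- position deviation: `δq_k(τ') = ∫ δp_k`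
    have hδq : (zn τ').1 ⟨k, by omega⟩ - (zN τ').1 ⟨k, by omega⟩ =
        ∫ s in (0:ℝ)..τ', ((zn s).2 ⟨k, by omega⟩ - (zN s).2 ⟨k, by omega⟩) := by
      rw [intervalIntegral.integral_sub (hp1'.intervalIntegrable _ _) (hp1.intervalIntegrable _ _)]
      have h1 := pinnedChain_chainFlow_fst_apply hω hl hβ hγ N x hηN ⟨k, by omega⟩ hτ'0
      have h2 := pinnedChain_chainFlow_fst_apply hω hl hβ hγ (ℓ + 1) x' hηn ⟨k, by omega⟩ hτ'0
      simp only [hzn, hzN]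
      rw [h1, h2, hx1 k hk.le]
      ring
    -- momentum deviation: `δp_k(τ') = ∫ δY_k` (initial data and noise cancel)
    have hδp : (zn τ').2 ⟨k, by omega⟩ - (zN τ').2 ⟨k, by omega⟩ =
        ∫ s in (0:ℝ)..τ', ((P.drift (ℓ + 1) (zn s)).2 ⟨k, by omega⟩ - (P.drift N (zN s)).2 ⟨k, by omega⟩) := by
      rw [intervalIntegral.integral_sub (hY1'.intervalIntegrable _ _) (hY1.intervalIntegrable _ _)]
      have h1 := pinnedChain_chainFlow_snd_apply hω hl hβ hγ N x hηN ⟨k, by omega⟩ hτ'0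
      have h2 := pinnedChain_chainFlow_snd_apply hω hl hβ hγ (ℓ + 1) x' hηn ⟨k, by omega⟩ hτ'0
      simp only [hzn, hzN]
      rw [h1, h2, hx2 k hk.le, hη τ' k hk]
      ring
    -- pointwise bound of the drift deviation on `[0, τ']`
    have hdrift : ∀ s ∈ Icc 0 τ',
        |(P.drift (ℓ + 1) (zn s)).2 ⟨k, by omega⟩ - (P.drift N (zN s)).2 ⟨k, by omega⟩| ≤
          cU * w k s + cV * ((if k = 0 then 0 else w (k - 1) s) + (if k + 1 < ℓ then w (k + 1) s else 2 * R)) +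
            γ * w k s := by
      intro s hs
      have hst : s ∈ Icc 0 t := ⟨hs.1, hs.2.trans hτ't⟩
      -- position deviations on the window, with the boundary site bounded by `2R`
      set d : ℕ → ℝ := fun j => if hj : j ≤ ℓ then |(zn s).1 ⟨j, by omega⟩ - (zN s).1 ⟨j, by omega⟩| else 0
        with hd
      have hd0 : ∀ j, 0 ≤ d j := fun j => by simp only [hd]; split_ifs <;> simp
      have hdj : ∀ (j : ℕ) (hj : j ≤ ℓ), |(zn s).1 ⟨j, by omega⟩ - (zN s).1 ⟨j, by omega⟩| ≤ d j := by
        intro j hj; simp only [hd, dif_pos hj]; exact le_rfl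
      have hdw : ∀ (j : ℕ) (hj : j ≤ ℓ), d j ≤ w j s := by
        intro j hj
        rw [hw_eq j hj s]
        simp only [hd, dif_pos hj]
        exact le_add_of_nonneg_right (abs_nonneg _)
      have hdℓ : d ℓ ≤ 2 * R := by
        simp only [hd, dif_pos le_rfl]
        obtain ⟨hb1, hb2⟩ := hbox s hst ℓ le_rfl
        exact (abs_sub _ _).trans (by linarith)
      have hqb : ∀ (j : ℕ) (hj : j ≤ ℓ), |(zN s).1 ⟨j, by omega⟩| ≤ R := fun j hj => (hbox s hst j hj).1
      have hqb' : ∀ (j : ℕ) (hj : j ≤ ℓ), |(zn s).1 ⟨j, by omega⟩| ≤ R := fun j hj => (hbox s hst j hj).2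
      have he : |(zn s).2 ⟨k, by omega⟩ - (zN s).2 ⟨k, by omega⟩| ≤ w k s := by
        rw [hw_eq k hk.le s]
        exact le_add_of_nonneg_left (abs_nonneg _)
      have h := pinnedChain_abs_drift_window_sub_le hω.le hl hβ hγ hℓN hqb hqb' hd0 hdj k hk he
      refine h.trans ?_
      have h1 : d k ≤ w k s := hdw k hk.le
      have h2 : (if k = 0 then 0 else d (k - 1)) ≤ (if k = 0 then 0 else w (k - 1) s) := by
        split_ifs with hk0
        · exact le_rfl
        · exact hdw (k - 1) (by omega)
      have h3 : d (k + 1) ≤ (if k + 1 < ℓ then w (k + 1) s else 2 * R) := by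
        split_ifs with hk1
        · exact hdw (k + 1) (by omega)
        · have : k + 1 = ℓ := by omega
          rw [this]; exact hdℓ
      have hcU0 : 0 ≤ cU := by positivity
      change cU * d k + cV * ((if k = 0 then 0 else d (k - 1)) + d (k + 1)) + γ * w k s ≤ _
      nlinarith
    -- continuity of the bounding integrand
    have hLc : Continuous fun s => (if k = 0 then (0:ℝ) else w (k - 1) s) := by
      split_ifs with hk0
      · exact continuous_const
      · exact hw_cont' (k - 1) (by omega)
    have hRc : Continuous fun s => (if k + 1 < ℓ then w (k + 1) s else 2 * R) := by
      split_ifs with hk1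
      · exact hw_cont' (k + 1) (by omega)
      · exact continuous_const
    have hwkc : Continuous (w k) := hw_cont' k hk.le
    -- `|δq_k(τ')| ≤ ∫ w_k`
    have hq_le : |(zn τ').1 ⟨k, by omega⟩ - (zN τ').1 ⟨k, by omega⟩| ≤ ∫ s in (0:ℝ)..τ', w k s := by
      rw [hδq]
      refine abs_intervalIntegral_le_of_abs_le hτ'0 (hp1'.sub hp1).continuousOn hwkc.continuousOn ?_
      intro s hs
      rw [hw_eq k hk.le s]
      exact le_add_of_nonneg_left (abs_nonneg _)
    -- `|δp_k(τ')| ≤ ∫ (cU w_k + cV (…) + γ w_k)`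
    have hgc : Continuous fun s => cU * w k s +
        cV * ((if k = 0 then 0 else w (k - 1) s) + (if k + 1 < ℓ then w (k + 1) s else 2 * R)) + γ * w k s :=
      ((hwkc.const_mul cU).add ((hLc.add hRc).const_mul cV)).add (hwkc.const_mul γ)
    have hp_le : |(zn τ').2 ⟨k, by omega⟩ - (zN τ').2 ⟨k, by omega⟩| ≤ ∫ s in (0:ℝ)..τ',
        (cU * w k s + cV * ((if k = 0 then 0 else w (k - 1) s) + (if k + 1 < ℓ then w (k + 1) s else 2 * R)) +
          γ * w k s) := by
      rw [hδp]
      exact abs_intervalIntegral_le_of_abs_le hτ'0 (hY1'.sub hY1).continuousOn hgc.continuousOn hdrift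
    -- assemble
    have hsumc : Continuous fun s => w k s + (cU * w k s +
        cV * ((if k = 0 then 0 else w (k - 1) s) + (if k + 1 < ℓ then w (k + 1) s else 2 * R)) + γ * w k s) :=
      hwkc.add hgc
    have hbndc : Continuous fun s => A * ((if k = 0 then 0 else w (k - 1) s) + w k s +
        (if k + 1 < ℓ then w (k + 1) s else 2 * R)) := ((hLc.add hwkc).add hRc).const_mul A
    rw [hw_eq k hk.le τ']
    refine (add_le_add hq_le hp_le).trans ?_
    rw [← intervalIntegral.integral_add (hwkc.intervalIntegrable _ _) (hgc.intervalIntegrable _ _),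
      ← intervalIntegral.integral_const_mul]
    refine intervalIntegral.integral_mono_on hτ'0 (hsumc.intervalIntegrable _ _) (hbndc.intervalIntegrable _ _)
      fun s hs => ?_
    · have h1 := hw_nn k s
      have h2 : 0 ≤ (if k = 0 then 0 else w (k - 1) s) := by split_ifs <;> simp [hw_nn]
      have h3 : 0 ≤ (if k + 1 < ℓ then w (k + 1) s else 2 * R) := by split_ifs <;> first | exact hw_nn _ _ | positivity
      rw [← hAU]
      nlinarith
  -- the abstract iteration at the boundary site `k = 0`
  have hS : (0:ℝ) ≤ 2 * R := by positivity
  have hSB : 2 * R ≤ B := le_max_right _ _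
  have key := boundary_lattice_iteration (ℓ := ℓ) (t := t) hA0 hS hSB hw_cont hw_bd hw_int 0 (by omega) τ hτ
  rw [Nat.sub_zero, hw_eq 0 (Nat.zero_le ℓ) τ] at key
  rw [abs_sub_comm]
  exact (le_add_of_nonneg_left (abs_nonneg _)).trans key

end Summit.AtomisticToContinuum.FouriersLaw.Theorems.HalfChainLocality

end
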